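import Summits.HodgeConjecture.CorCM.TwoGroupExtraspecialTable
import HarnessLib

/-!
# A cyclic subgroup of order `16` and index two: the table model on `ℤ/16 × 𝔽₂` (law A at order `32`)

COR-CM (cell `pub-hodgecm2`), binder seat b04 (gen 36), count-neutral own lane «Galois-CM-type classification».  KERNEL ONLY, pure
group theory: theorems; no definition, no named fact, no `sorry`.  The order-`32` analogue of gen 17's law A
(`GaloisTableLaws.exists_table_lawA`, `ℤ/8 × 𝔽₂`): `|G| = 32`, `r` of order `16`, `s ∉ ⟨r⟩` with `s r = r^μ s`, `s² = r^τ`; the word map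
`(i, j) ↦ rⁱ sʲ` inverts to a TABLE MODEL `e : G ≃ ℤ/16 × 𝔽₂` of the law `(i,j)(i',j') = (i + μʲ i' + τ jj', j + j')`
(**`exists_table_lawA_sixteen`**; `(μ, τ) = (15, 0)`: `D₃₂`, `(15, 8)`: `Q₃₂`, `(7, 0)`: `SD₃₂`, `(9, 0)`: `M₃₂`).  The unit and
left-inverse identities of the law (`(i,0)⁻¹ = (-i,0)`, `(i,1)⁻¹ = (-μ(τ+i), 1)`) are hypotheses, `decide`d at concrete `(μ, τ)` —
quadratic in `|X|` (`CorCM/TwoGroupExtraspecialTable.exists_table_equiv_of_words_inv`) instead of gen 17's cubic cancellation.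
Used by `CorCM/GaloisThirtyTwoOrderSixteenBranch` (an automorphism of order `16` in a GOOD field of degree `32`).

## References

* [Rotman1995] J. J. Rotman, *An Introduction to the Theory of Groups*, 4th ed., GTM 148, Thm. 5.46 and §5.
-/

namespace Summit.HodgeConjecture.CorCM.GaloisModels.CyclicSixteen

open Summit.HodgeConjecture.CorCM.GaloisTableLaws
open Summit.HodgeConjecture.CorCM.GaloisModels.FrattiniTwo (exists_table_equiv_of_words_inv)

variable {G : Type*} [Group G]

/-- The `(r, s)`-words multiply by law A modulo `16`: `(rⁱ sʲ)(rⁱ' sʲ') = r^{i + μʲ i' + τ jj'} s^{j+j'}`, exponents in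
`ℤ/16 × 𝔽₂`. [folklore] -/
theorem lawA_sixteen_words_mul (r s : G) (μ τ : ZMod 16) (hr16 : r ^ 16 = 1) (hsr : s * r = r ^ μ.val * s)
    (hss : s * s = r ^ τ.val) (i : ZMod 16) (j : ZMod 2) (i' : ZMod 16) (j' : ZMod 2) :
    (r ^ i.val * s ^ j.val) * (r ^ i'.val * s ^ j'.val) =
      r ^ (i + (if j = 0 then i' else μ * i') + (if j = 1 ∧ j' = 1 then τ else 0)).val * s ^ (j + j').val := by
  have hv0 : (0 : ZMod 2).val = 0 := rfl
  have hv1 : (1 : ZMod 2).val = 1 := rfl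
  have hvμ : (μ * i').val % 16 = μ.val * i'.val % 16 := by rw [ZMod.val_mul]; exact Nat.mod_mod _ _
  obtain ⟨n00, n01, n10, n11⟩ := lawA_nf r s μ.val τ.val hsr hss i.val i'.val
  rcases zmod2_cases j with rfl | rfl <;> rcases zmod2_cases j' with rfl | rfl
  · rw [if_pos rfl, if_neg (by decide), add_zero, hv0, show ((0 : ZMod 2) + 0).val = 0 from rfl, n00,
      pow_eq_pow_of_mod_eq r hr16 (a := (i + i').val) (b := i.val + i'.val) (by rw [ZMod.val_add]; omega)]
  · rw [if_pos rfl, if_neg (by decide), add_zero, hv0, hv1, show ((0 : ZMod 2) + 1).val = 1 from rfl, n01,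
      pow_eq_pow_of_mod_eq r hr16 (a := (i + i').val) (b := i.val + i'.val) (by rw [ZMod.val_add]; omega)]
  · rw [if_neg (by decide), if_neg (by decide), add_zero, hv0, hv1, show ((1 : ZMod 2) + 0).val = 1 from rfl, n10,
      pow_eq_pow_of_mod_eq r hr16 (a := (i + μ * i').val) (b := i.val + μ.val * i'.val) (by
        rw [ZMod.val_add]; generalize μ.val * i'.val = M at hvμ ⊢; omega)]
  · rw [if_neg (by decide), if_pos ⟨rfl, rfl⟩, hv1, show ((1 : ZMod 2) + 1).val = 0 from rfl, n11,
      pow_eq_pow_of_mod_eq r hr16 (a := (i + μ * i' + τ).val) (b := i.val + μ.val * i'.val + τ.val) (by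
        rw [ZMod.val_add, ZMod.val_add]; generalize μ.val * i'.val = M at hvμ ⊢; omega)]

variable [Finite G]

/-- **Table model for law A at order `32`.**  `|G| = 32`, `orderOf r = 16`, `s ∉ ⟨r⟩`, `s r = r^μ s`, `s² = r^τ`; `mul` an operation on
`ℤ/16 × 𝔽₂` agreeing with `(i,j)(i',j') = (i + μʲ i' + τ jj', j + j')`, with `mul p 0 = p` and the left-inverse identity for the
explicit inverse.  Then there is a table model `e : G ≃ ℤ/16 × 𝔽₂` with `e (rⁱ sʲ) = (i, j)` (so `e r = (1,0)`, `e s = (0,1)`,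
`e 1 = 0`). [folklore] -/
theorem exists_table_lawA_sixteen (hcard : Nat.card G = 32) {r s : G} (μ τ : ZMod 16) (hr : orderOf r = 16)
    (hs : s ∉ Subgroup.zpowers r) (hsr : s * r = r ^ μ.val * s) (hss : s * s = r ^ τ.val)
    (mul : ZMod 16 × ZMod 2 → ZMod 16 × ZMod 2 → ZMod 16 × ZMod 2)
    (hm : ∀ p q : ZMod 16 × ZMod 2, mul p q =
      (p.1 + (if p.2 = 0 then q.1 else μ * q.1) + (if p.2 = 1 ∧ q.2 = 1 then τ else 0), p.2 + q.2))
    (ho : ∀ p : ZMod 16 × ZMod 2, mul p (0, 0) = p)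
    (hlinv : ∀ p q : ZMod 16 × ZMod 2,
      mul (if p.2 = 0 then (-p.1, 0) else (-(μ * (τ + p.1)), 1)) (mul p q) = q) :
    ∃ e : G ≃ ZMod 16 × ZMod 2, (∀ g h : G, e (g * h) = mul (e g) (e h)) ∧
      ∀ p : ZMod 16 × ZMod 2, e (r ^ p.1.val * s ^ p.2.val) = p := by
  have hv0 : (0 : ZMod 2).val = 0 := rfl
  have hv1 : (1 : ZMod 2).val = 1 := rfl
  have hr16 : r ^ 16 = 1 := by rw [← hr]; exact pow_orderOf_eq_one r
  set f : ZMod 16 × ZMod 2 → G := fun p => r ^ p.1.val * s ^ p.2.val with hf_def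
  have hf : ∀ p q, f (mul p q) = f p * f q := by
    rintro ⟨i, j⟩ ⟨i', j'⟩
    rw [hm]
    simp only [hf_def]
    exact (lawA_sixteen_words_mul r s μ τ hr16 hsr hss i j i' j').symm
  have hker : ∀ p, f p = 1 → p = (0, 0) := by
    rintro ⟨i, j⟩ h
    simp only [hf_def] at h
    rcases zmod2_cases j with rfl | rfl
    · rw [hv0, pow_zero, mul_one] at h
      have hdvd : orderOf r ∣ i.val := orderOf_dvd_of_pow_eq_one h
      rw [hr] at hdvd
      have hi : i.val = 0 := by have := ZMod.val_lt i; omega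
      rw [ZMod.val_eq_zero] at hi
      rw [hi]
    · exfalso
      rw [hv1, pow_one] at h
      apply hs
      have : s = (r ^ i.val)⁻¹ := eq_inv_of_mul_eq_one_right h
      rw [this]
      exact Subgroup.inv_mem _ (Subgroup.pow_mem _ (Subgroup.mem_zpowers r) _)
  have hfo : f (0, 0) = 1 := by simp only [hf_def, hv0, ZMod.val_zero, pow_zero, mul_one]
  obtain ⟨e, he, hef⟩ := exists_table_equiv_of_words_inv mul (0, 0) _ f hf hker hfo ho hlinv
    (by rw [hcard]; simp [ZMod.card])
  exact ⟨e, he, fun p => hef p⟩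

end Summit.HodgeConjecture.CorCM.GaloisModels.CyclicSixteen
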